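import Summits.Ventures.Crystal3D.StickySpheres.FccChunks
import HarnessLib

/-!
# Finite pieces of the face-centred cubic lattice: integer boxes and a contact count by offsets

HONEST FRAMING. Part of the venture `Summits/Ventures/Crystal3D` (cell `pub-crystal3d`; seat p3 g11).
Construction-side bookkeeping for the sharper all-`N` fcc lower bound on the sticky-sphere contact
number `C(N) = maxContacts 3 N` (`StickySpheres/FccStaircase.lean`, `StickySpheres/FccAllN.lean`): for ANY
finite set `S` of coefficient vectors (primitive fcc basis of `StickySpheres/FccChunks.lean`, `fccPoint`)
the scaled points form a unit packing `latConfig S` of `S.card` balls (parity lemma of `FccChunks`), and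
twice its contact number is at least `∑_{δ ∈ fccOffsets} #{a ∈ S | a + δ ∈ S}`
(`sum_card_filter_le_two_mul_numContacts`: each present lattice neighbour is a contact neighbour);
integer boxes `box lo hi` (products of half-open integer intervals, `Fintype.piFinset`) with their
cardinality, and the two-set counting lemma `card_add_card_le_of_two_sets` used direction by direction.
Elementary [folklore]; nothing is claimed about ground states and no number of the cell moves.
-/

noncomputable section

open scoped BigOperators
open Finset

namespace Summit.Ventures.Crystal3D

open Literature.Geometry.DiscreteGeometry (sqNormInt)
open Literature.Barriers.AtomisticToContinuum (intConfig)

/-! ## Integer boxes -/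

/-- The integer box `∏ₖ [lo k, hi k)` in `ℤ³`. -/
def box (lo hi : Fin 3 → ℤ) : Finset (Fin 3 → ℤ) :=
  Fintype.piFinset fun k => Finset.Ico (lo k) (hi k)

/-- Membership in a box is the conjunction of the coordinate bounds. -/
theorem mem_box {lo hi : Fin 3 → ℤ} {a : Fin 3 → ℤ} :
    a ∈ box lo hi ↔ ∀ k, lo k ≤ a k ∧ a k < hi k := by
  simp [box, Fintype.mem_piFinset]

/-- The cardinality of a box is the product of its (truncated) side lengths. -/
theorem card_box (lo hi : Fin 3 → ℤ) : (box lo hi).card = ∏ k, (hi k - lo k).toNat := by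
  simp [box, Fintype.card_piFinset, Int.card_Ico]

/-- The cardinality of a box with natural-number corners `lo ≤ hi`. -/
theorem card_box_natCast (lo hi : Fin 3 → ℕ) (h : ∀ k, lo k ≤ hi k) :
    (box (fun k => (lo k : ℤ)) (fun k => (hi k : ℤ))).card = ∏ k, (hi k - lo k) := by
  rw [card_box]
  refine Finset.prod_congr rfl fun k _ => ?_
  rw [← Nat.cast_sub (h k), Int.toNat_natCast]

/-! ## Configurations carried by finite sets of fcc coefficient vectors -/

variable (S : Finset (Fin 3 → ℤ))

/-- A fixed labelling of the finite set `S` by `Fin S.card`. -/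
def latIdx : Fin S.card ≃ S := S.equivFin.symm

/-- Integer model: label `i ↦ fccPoint (a_i)` with `a_i` the `i`-th coefficient vector of `S`. -/
def latInt (i : Fin S.card) : Fin 3 → ℤ := fccPoint ((latIdx S i : S) : Fin 3 → ℤ)

/-- **The fcc piece carried by `S`** (diameter `1`): the integer model scaled by `1/√2`. -/
def latConfig : Fin S.card → EuclideanSpace ℝ (Fin 3) :=
  intConfig (latInt S) (1 / Real.sqrt (2 : ℕ))

/-- Distinct balls of an fcc piece are at integer squared distance `≥ 2` (parity lemma). -/
theorem sep_latConfig : ∀ i j : Fin S.card, i ≠ j →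
    (2 : ℤ) ≤ sqNormInt (latInt S i - latInt S j) := by
  intro i j hij
  rw [latInt, latInt, fccPoint_sub]
  refine two_le_sqNormInt_of_even ?_ ⟨_, fccPoint_sum_even _⟩
  intro h
  have h0 := sub_eq_zero.1 (fccPoint_eq_zero h)
  exact hij ((latIdx S).injective (Subtype.ext h0))

/-- An fcc piece is a unit packing. -/
theorem isUnitPacking_latConfig : IsUnitPacking (latConfig S) :=
  isUnitPacking_intConfig (latInt S) (by norm_num) (by exact_mod_cast sep_latConfig S)

variable {S}

/-- The label of the lattice neighbour `a_i + δ` when it lies in `S` (junk `i` otherwise). -/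
def nbLabel (i : Fin S.card) (δ : Fin 3 → ℤ) : Fin S.card :=
  if h : ((latIdx S i : S) : Fin 3 → ℤ) + δ ∈ S then (latIdx S).symm ⟨_, h⟩ else i

/-- The coefficient vector of `nbLabel i δ` is `a_i + δ` when `a_i + δ ∈ S`. -/
theorem coe_latIdx_nbLabel {i : Fin S.card} {δ : Fin 3 → ℤ}
    (h : ((latIdx S i : S) : Fin 3 → ℤ) + δ ∈ S) :
    ((latIdx S (nbLabel i δ) : S) : Fin 3 → ℤ) = ((latIdx S i : S) : Fin 3 → ℤ) + δ := by
  simp [nbLabel, h]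

/-- A lattice neighbour present in `S` is a contact neighbour in the packing. -/
theorem nbLabel_mem_contactNeighbors {i : Fin S.card} {δ : Fin 3 → ℤ} (hδ : δ ∈ fccOffsets)
    (h : ((latIdx S i : S) : Fin 3 → ℤ) + δ ∈ S) :
    nbLabel i δ ∈ contactNeighbors (latConfig S) i := by
  rw [mem_contactNeighbors]
  have hc := coe_latIdx_nbLabel h
  refine ⟨?_, ?_⟩
  · intro he
    rw [he] at hc
    apply fccOffsets_ne_zero δ hδ
    have : ((latIdx S i : S) : Fin 3 → ℤ) + δ = ((latIdx S i : S) : Fin 3 → ℤ) + 0 := by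
      rw [add_zero]; exact hc.symm
    exact add_left_cancel this
  · rw [latConfig, dist_intConfig_inv_sqrt (latInt S) (by norm_num : 0 < 2)]
    have hdiff : latInt S i - latInt S (nbLabel i δ) = fccPoint (-δ) := by
      rw [latInt, latInt, fccPoint_sub, hc]
      congr 1; abel
    rw [hdiff, fccPoint_neg, sqNormInt_neg, sqNormInt_fccOffsets δ hδ]
    norm_num

/-- Distinct present offsets give distinct contact neighbours. -/
theorem nbLabel_injOn (i : Fin S.card) :
    Set.InjOn (nbLabel i) ↑(fccOffsets.filter fun δ => ((latIdx S i : S) : Fin 3 → ℤ) + δ ∈ S) := by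
  intro δ hδ δ' hδ' he
  have h1 := coe_latIdx_nbLabel (mem_filter.1 hδ).2
  have h2 := coe_latIdx_nbLabel (mem_filter.1 hδ').2
  rw [he] at h1
  rw [h1] at h2
  exact add_left_cancel h2

/-- **Each ball has at least as many contacts as lattice neighbours present in `S`.** -/
theorem card_filter_offsets_le_coordination (i : Fin S.card) :
    (fccOffsets.filter fun δ => ((latIdx S i : S) : Fin 3 → ℤ) + δ ∈ S).card ≤
      coordination (latConfig S) i := by
  rw [coordination]
  exact card_le_card_of_injOn (nbLabel i)
    (fun δ hδ => nbLabel_mem_contactNeighbors (mem_filter.1 hδ).1 (mem_filter.1 hδ).2)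
    (nbLabel_injOn i)

/-- **Contact count by offsets**: `∑_{δ ∈ fccOffsets} #{a ∈ S | a + δ ∈ S} ≤ 2 · C(latConfig S)`. -/
theorem sum_card_filter_le_two_mul_numContacts :
    ∑ δ ∈ fccOffsets, (S.filter fun a => a + δ ∈ S).card ≤ 2 * numContacts (latConfig S) := by
  classical
  -- rewrite the left side as a sum over the balls of the numbers of present offsets
  have hswap : ∑ δ ∈ fccOffsets, (S.filter fun a => a + δ ∈ S).card =
      ∑ a ∈ S, (fccOffsets.filter fun δ => a + δ ∈ S).card := by
    simp only [card_filter]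
    exact Finset.sum_comm
  have hlab : ∑ a ∈ S, (fccOffsets.filter fun δ => a + δ ∈ S).card =
      ∑ i : Fin S.card, (fccOffsets.filter fun δ => ((latIdx S i : S) : Fin 3 → ℤ) + δ ∈ S).card := by
    rw [← Finset.sum_coe_sort S]
    exact (Fintype.sum_equiv (latIdx S) _ _ fun i => rfl).symm
  rw [hswap, hlab, ← sum_coordination_eq]
  exact sum_le_sum fun i _ => card_filter_offsets_le_coordination i

/-- **A box `T ⊆ S` with `T + δ ⊆ S` gives `#T` lattice contacts in direction `δ` …** -/
theorem card_box_le_card_filter {lo hi : Fin 3 → ℤ} {δ : Fin 3 → ℤ}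
    (hT : ∀ a ∈ box lo hi, a ∈ S ∧ a + δ ∈ S) :
    (box lo hi).card ≤ (S.filter fun a => a + δ ∈ S).card :=
  card_le_card fun a ha => mem_filter.2 (hT a ha)

/-- **… and `#T` lattice contacts in direction `-δ`** (at the shifted points). -/
theorem card_box_le_card_filter_neg {lo hi : Fin 3 → ℤ} {δ : Fin 3 → ℤ}
    (hT : ∀ a ∈ box lo hi, a ∈ S ∧ a + δ ∈ S) :
    (box lo hi).card ≤ (S.filter fun a => a + -δ ∈ S).card := by
  have him : (box lo hi).image (fun a => a + δ) ⊆ S.filter fun a => a + -δ ∈ S := by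
    intro b hb
    obtain ⟨a, ha, rfl⟩ := mem_image.1 hb
    refine mem_filter.2 ⟨(hT a ha).2, ?_⟩
    simpa using (hT a ha).1
  calc (box lo hi).card = ((box lo hi).image fun a => a + δ).card :=
        (card_image_of_injective _ (add_left_injective δ)).symm
    _ ≤ _ := card_le_card him

/-- Two DISJOINT sets `T₁, T₂ ⊆ S` with `Tᵢ + δ ⊆ S` give `#T₁ + #T₂` lattice contacts in direction
`δ` and as many in direction `-δ`. -/
theorem card_add_card_le_of_two_sets {T₁ T₂ : Finset (Fin 3 → ℤ)} {δ : Fin 3 → ℤ}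
    (h₁ : ∀ a ∈ T₁, a ∈ S ∧ a + δ ∈ S) (h₂ : ∀ a ∈ T₂, a ∈ S ∧ a + δ ∈ S) (hd : Disjoint T₁ T₂) :
    2 * (T₁.card + T₂.card) ≤
      (S.filter fun a => a + δ ∈ S).card + (S.filter fun a => a + -δ ∈ S).card := by
  have hU : ∀ a ∈ T₁ ∪ T₂, a ∈ S ∧ a + δ ∈ S := by
    intro a ha
    rcases mem_union.1 ha with h | h
    · exact h₁ a h
    · exact h₂ a h
  have hcard : (T₁ ∪ T₂).card = T₁.card + T₂.card := card_union_of_disjoint hd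
  have hpos : (T₁ ∪ T₂).card ≤ (S.filter fun a => a + δ ∈ S).card :=
    card_le_card fun a ha => mem_filter.2 (hU a ha)
  have hneg : (T₁ ∪ T₂).card ≤ (S.filter fun a => a + -δ ∈ S).card := by
    have him : (T₁ ∪ T₂).image (fun a => a + δ) ⊆ S.filter fun a => a + -δ ∈ S := by
      intro b hb
      obtain ⟨a, ha, rfl⟩ := mem_image.1 hb
      refine mem_filter.2 ⟨(hU a ha).2, ?_⟩
      simpa using (hU a ha).1
    calc (T₁ ∪ T₂).card = ((T₁ ∪ T₂).image fun a => a + δ).card :=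
          (card_image_of_injective _ (add_left_injective δ)).symm
      _ ≤ _ := card_le_card him
  omega

/-- **Witness bound**: an fcc piece shows `C(latConfig S) ≤ C(S.card)`. -/
theorem numContacts_latConfig_le_maxContacts : numContacts (latConfig S) ≤ maxContacts 3 S.card :=
  numContacts_le_maxContacts (isUnitPacking_latConfig S)

end Summit.Ventures.Crystal3D

end
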